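import Literature.NumberTheory.Automorphic.UnitaryGroupRestrictedProduct
import Literature.NumberTheory.Automorphic.AshSmithTheoryHeckeLevelProofs
import HarnessLib

/-!
# Principal congruence levels `K(𝔫) ∩ U(J)(𝔸_F)` of a unitary group, for a general hermitian form `J`

Registry: pub-hodgecm MODEL-CONSTRUCTION sub-cell, MODEL-DAG node **U2** (iv): "the compact open level subgroups
`K_f`". Companion of `UnitaryGroupLocalFactors` / `UnitaryGroupRestrictedProduct` (U2-i/ii).

For a quadratic extension `E/F` of number fields with `c ∈ Gal(E/F)`, a matrix `J ∈ M_N(E)` and a level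
`𝔫 ⊴ 𝓞_E`, the tree already has

* the principal congruence subgroup `K(𝔫) ≤ GL_N(𝔸_E)` (`principalCongruenceLevel N E 𝔫`, archimedean part
  trivial, `GLnAdelicStructure`), its finite part `K_f(𝔫) = ofFinite⁻¹ K(𝔫) ≤ GL_N(𝔸_E^∞)`, open and compact for
  `𝔫 ≠ 0` (`isOpen_comap_ofFinite_principalCongruenceLevel`, `isCompact_comap_ofFinite_principalCongruenceLevel`,
  `AshSmithTheoryHeckeLevelProofs`);
* for the QUASI-SPLIT form only, the trace `UnitaryGroup.level 𝔫 = U(𝔸_F) ∩ K(𝔫)` (`UnitaryGroupAutomorphicRep`,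
  no properties proved);
* the admissible levels `UnitaryGroup.finiteLevels J` of the automorphy datum of `U(J)` (traces of compact open
  subgroups of `GL_N(𝔸_E^∞)`).

This file supplies, for a GENERAL `J` (in particular the definite forms of the Picard / theta setting):

* `UnitaryGroup.congruenceLevel F E c N J 𝔫 ≤ U(J)(𝔸_F)` — the trace of `K(𝔫)`; for the quasi-split form it is
  the tree's `level` definitionally (`congruenceLevel_quasiSplit`);
* `UnitaryGroup.finCongruenceLevel F E c N J 𝔫 ≤ U(J)(𝔸_{F,f})` — its finite part inside the finite-adelic
  group `finAdelic` of U2-ii: **open and compact for `𝔫 ≠ 0`** (`isOpen_finCongruenceLevel`,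
  `isCompact_finCongruenceLevel`), contained in the integral level `K_f⁰` with equality at `𝔫 = ⊤`
  (`finCongruenceLevel_le_integralLevel`, `finCongruenceLevel_top`), and PLACEWISE: `g ∈ K_f(𝔫) ∩ U` iff
  `g_w ∈ K_w(|𝔫|_w)` for every finite place `w` of `E` (`mem_finCongruenceLevel_iff_forall`);
* the bridge `finAdelicToAdelic g ∈ congruenceLevel ↔ g ∈ finCongruenceLevel` and
  **`congruenceLevel … J 𝔫 ∈ finiteLevels … J`** for `𝔫 ≠ 0` (`congruenceLevel_mem_finiteLevels`): the principal
  congruence levels are admissible levels of the automorphy datum `UnitaryGroup.automorphyDatum … J`, so the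
  tree's `AutomorphyDatum` machinery (automorphic forms of level `K(𝔫)`, Hecke operators) applies to them.

References: Borel–Jacquet, Corvallis 1979, §4.1 (levels of `G(𝔸_f)` for a reductive `G`); Platonov–Rapinchuk 1994,
§5.1 (congruence subgroups of adelic groups); Bump, *Automorphic forms and representations*, §3.3.
Everything here is elementary and proved; no published theorem is cited as a hypothesis.
-/

noncomputable section

open NumberField IsDedekindDomain Topology

open scoped Matrix MatrixGroups

namespace Literature.NumberTheory.Automorphic

namespace UnitaryGroup

variable (F E : Type) [Field F] [NumberField F] [Field E] [NumberField E] [Algebra F E]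
  (c : E ≃ₐ[F] E) (N : ℕ) (J : Matrix (Fin N) (Fin N) E)

/-! ## 1. The adelic congruence level `U(J)(𝔸_F) ∩ K(𝔫)` -/

/-- **The principal congruence level `K_U(𝔫) = U(J)(𝔸_F) ∩ K(𝔫)`** of `U(J)` for a general form `J`: the trace
of the tree's principal congruence subgroup `K(𝔫) ≤ GL_N(𝔸_E)` (archimedean component `1`, finite component
`≡ 1 mod 𝔫`). Borel–Jacquet 1979, §4.1. [cite: BorelJacquet1979, §4.1] -/
def congruenceLevel (𝔫 : Ideal (𝓞 E)) : Subgroup (adelicGroupData F E c N J).Adelic :=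
  (principalCongruenceLevel N E 𝔫).comap (adelicVal F E c N J)

/-- Membership in `K_U(𝔫)` (definitional). [folklore] -/
theorem mem_congruenceLevel_iff (𝔫 : Ideal (𝓞 E)) (g : (adelicGroupData F E c N J).Adelic) :
    g ∈ congruenceLevel F E c N J 𝔫 ↔ adelicVal F E c N J g ∈ principalCongruenceLevel N E 𝔫 :=
  Iff.rfl

/-- For the quasi-split form `J_N` this is the tree's `UnitaryGroup.level` (definitionally). [folklore] -/
theorem congruenceLevel_quasiSplit (𝔫 : Ideal (𝓞 E)) :
    congruenceLevel F E c N ((StdForm.antidiagonal N).over E) 𝔫 = level F E c N 𝔫 :=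
  rfl

/-- Every congruence level lies in the level-one group: `K_U(𝔫) ≤ K_U(1) = U(J)(𝔸_F) ∩ K^max`. [folklore] -/
theorem congruenceLevel_le_top (𝔫 : Ideal (𝓞 E)) :
    congruenceLevel F E c N J 𝔫 ≤ congruenceLevel F E c N J ⊤ := by
  intro g hg
  rw [mem_congruenceLevel_iff, principalCongruenceLevel_top]
  exact principalCongruenceLevel_le N E 𝔫 hg

/-! ## 2. The finite part `K_f(𝔫) ∩ U(J)(𝔸_{F,f})` -/

/-- **The finite congruence level `U(J)(𝔸_{F,f}) ∩ K_f(𝔫)`**: elements of the finite-adelic unitary group whose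
underlying finite-adelic matrix lies in `K_f(𝔫) = ofFinite⁻¹ K(𝔫)`. Borel–Jacquet 1979, §4.1. [cite: BorelJacquet1979, §4.1] -/
def finCongruenceLevel (𝔫 : Ideal (𝓞 E)) : Subgroup (finAdelic F E c N J) :=
  ((principalCongruenceLevel N E 𝔫).comap (GLn.ofFinite N E)).subgroupOf (finAdelic F E c N J)

omit [NumberField F] in
/-- Membership in the finite congruence level (definitional). [folklore] -/
theorem mem_finCongruenceLevel_iff (𝔫 : Ideal (𝓞 E)) (g : finAdelic F E c N J) :
    g ∈ finCongruenceLevel F E c N J 𝔫 ↔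
      GLn.ofFinite N E (g : GL (Fin N) (FiniteAdeleRing (𝓞 E) E)) ∈ principalCongruenceLevel N E 𝔫 :=
  Iff.rfl

/-- **Bridge to the adelic level**: `(1, g) ∈ K_U(𝔫) ↔ g ∈ K_{U,f}(𝔫)`. [folklore] -/
theorem finAdelicToAdelic_mem_congruenceLevel_iff (𝔫 : Ideal (𝓞 E)) (g : finAdelic F E c N J) :
    finAdelicToAdelic F E c N J g ∈ congruenceLevel F E c N J 𝔫 ↔ g ∈ finCongruenceLevel F E c N J 𝔫 := by
  rw [mem_congruenceLevel_iff, adelicVal_finAdelicToAdelic, mem_finCongruenceLevel_iff]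

omit [NumberField F] in
/-- **Placewise description**: `g ∈ K_{U,f}(𝔫)` iff for every finite place `w` of `E` the `w`-component
`g_w ∈ GL_N(E_w)` lies in the valued congruence subgroup `K_w(|𝔫|_w)` (integral, `≡ 1 mod 𝔫𝒪_w`).
Platonov–Rapinchuk 1994, §5.1. [cite: PlatonovRapinchuk1994, §5.1] -/
theorem mem_finCongruenceLevel_iff_forall (𝔫 : Ideal (𝓞 E)) (g : finAdelic F E c N J) :
    g ∈ finCongruenceLevel F E c N J 𝔫 ↔
      ∀ w : HeightOneSpectrum (𝓞 E), GLn.evalAt N E w (g : GL (Fin N) (FiniteAdeleRing (𝓞 E) E)) ∈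
        valuedCongruenceSubgroup (Fin N) (idealRadius E w 𝔫) := by
  rw [mem_finCongruenceLevel_iff, mem_principalCongruenceLevel_iff]
  simp only [toLocal_ofFinite]
  constructor
  · exact fun h => h.2
  · intro h
    refine ⟨GLn.ofFinite_mem_glIntegralLevel ?_, h⟩
    rw [GLn.mem_glFiniteIntegralLevel_iff_forall_evalAt]
    intro w
    obtain ⟨h₁, h₂, -⟩ := h w
    rw [GLn.evalAt_mem_glInt_iff]
    refine ⟨fun i j => (HeightOneSpectrum.mem_adicCompletionIntegers (R := 𝓞 E) E w).2 (h₁ i j),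
      fun i j => (HeightOneSpectrum.mem_adicCompletionIntegers (R := 𝓞 E) E w).2 ?_⟩
    have := h₂ i j
    rwa [← map_inv] at this

omit [NumberField F] in
/-- `K_{U,f}(𝔫) ≤ K_f⁰ = U ∩ GL_N(𝒪̂_E)` (the integral level of U2-ii). [folklore] -/
theorem finCongruenceLevel_le_integralLevel (𝔫 : Ideal (𝓞 E)) :
    finCongruenceLevel F E c N J 𝔫 ≤ finAdelicIntegralLevel F E c N J := fun _ hg =>
  comap_ofFinite_principalCongruenceLevel_le N E 𝔫 hg

omit [NumberField F] in
/-- At level `𝔫 = 𝓞_E` the congruence level is the whole integral level `K_f⁰`. [folklore] -/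
@[simp] theorem finCongruenceLevel_top :
    finCongruenceLevel F E c N J ⊤ = finAdelicIntegralLevel F E c N J := by
  refine le_antisymm (finCongruenceLevel_le_integralLevel F E c N J ⊤) fun g hg => ?_
  rw [mem_finCongruenceLevel_iff, principalCongruenceLevel_top]
  exact GLn.ofFinite_mem_glIntegralLevel hg

omit [NumberField F] in
/-- **`K_{U,f}(𝔫)` is open** in `U(J)(𝔸_{F,f})` for `𝔫 ≠ 0` (trace of the open `K_f(𝔫)`). Bump §3.3.
[folklore] -/
theorem isOpen_finCongruenceLevel {𝔫 : Ideal (𝓞 E)} (h𝔫 : 𝔫 ≠ 0) :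
    IsOpen (finCongruenceLevel F E c N J 𝔫 : Set (finAdelic F E c N J)) :=
  (isOpen_comap_ofFinite_principalCongruenceLevel N E h𝔫).preimage continuous_subtype_val

omit [NumberField F] in
/-- **`K_{U,f}(𝔫)` is compact** for `𝔫 ≠ 0` (the closed subgroup `U(J)(𝔸_{F,f}) ≤ GL_N(𝔸_E^∞)` meets the compact
`K_f(𝔫)`). Platonov–Rapinchuk 1994, §5.1. [cite: PlatonovRapinchuk1994, §5.1] -/
theorem isCompact_finCongruenceLevel {𝔫 : Ideal (𝓞 E)} (h𝔫 : 𝔫 ≠ 0) :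
    IsCompact (finCongruenceLevel F E c N J 𝔫 : Set (finAdelic F E c N J)) :=
  (isClosed_finAdelic F E c N J).isClosedEmbedding_subtypeVal.isCompact_preimage
    (isCompact_comap_ofFinite_principalCongruenceLevel N E h𝔫)

/-! ## 3. `K_U(𝔫)` is an admissible level of the automorphy datum of `U(J)` -/

omit [NumberField F] in
/-- `K(𝔫) = ofFinite (K_f(𝔫))` inside `GL_N(𝔸_E)` (the archimedean component of `K(𝔫) ≤ K^max` is `1`).
[folklore] -/
theorem principalCongruenceLevel_eq_map_comap_ofFinite (𝔫 : Ideal (𝓞 E)) :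
    principalCongruenceLevel N E 𝔫 =
      ((principalCongruenceLevel N E 𝔫).comap (GLn.ofFinite N E)).map (GLn.ofFinite N E) := by
  refine le_antisymm (fun g hg => ?_) (Subgroup.map_comap_le _ _)
  refine Subgroup.mem_map.2
    ⟨GLn.sndHom N E g, ?_, GLn.ofFinite_sndHom_of_mem (principalCongruenceLevel_le N E 𝔫 hg)⟩
  rw [Subgroup.mem_comap, GLn.ofFinite_sndHom_of_mem (principalCongruenceLevel_le N E 𝔫 hg)]
  exact hg

/-- `K_U(𝔫)` is the trace of `ofFinite (K_f(𝔫))` on `U(J)(𝔸_F)` — the shape of the members of `finiteLevels`.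
[folklore] -/
theorem congruenceLevel_eq_comap_map (𝔫 : Ideal (𝓞 E)) :
    congruenceLevel F E c N J 𝔫 =
      ((((principalCongruenceLevel N E 𝔫).comap (GLn.ofFinite N E)).map (GLn.ofFinite N E)).comap
        (adelic F E c N J).subtype) := by
  rw [congruenceLevel, ← principalCongruenceLevel_eq_map_comap_ofFinite]
  rfl

/-- **The principal congruence levels are admissible levels of `U(J)`**: `K_U(𝔫) ∈ finiteLevels J` for `𝔫 ≠ 0`,
with compact open finite part `K_f(𝔫)`. Hence the tree's `AutomorphyDatum` notions (automorphic forms of level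
`K_U(𝔫)`, Hecke operators at that level) apply to `UnitaryGroup.automorphyDatum … J`. Borel–Jacquet 1979, §4.1.
[cite: BorelJacquet1979, §4.1] -/
theorem congruenceLevel_mem_finiteLevels {𝔫 : Ideal (𝓞 E)} (h𝔫 : 𝔫 ≠ 0) :
    congruenceLevel F E c N J 𝔫 ∈ finiteLevels F E c N J :=
  ⟨(principalCongruenceLevel N E 𝔫).comap (GLn.ofFinite N E),
    isOpen_comap_ofFinite_principalCongruenceLevel N E h𝔫,
    isCompact_comap_ofFinite_principalCongruenceLevel N E h𝔫,
    congruenceLevel_eq_comap_map F E c N J 𝔫⟩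

/-- The image of `K_{U,f}(𝔫)` under `g ↦ (1, g)` is `K_U(𝔫)`. [folklore] -/
theorem map_finAdelicToAdelic_finCongruenceLevel (𝔫 : Ideal (𝓞 E)) :
    (finCongruenceLevel F E c N J 𝔫).map (finAdelicToAdelic F E c N J) = congruenceLevel F E c N J 𝔫 := by
  refine le_antisymm ?_ fun g hg => ?_
  · rintro _ ⟨g, hg, rfl⟩
    exact (finAdelicToAdelic_mem_congruenceLevel_iff F E c N J 𝔫 g).2 hg
  · have hg' := principalCongruenceLevel_le N E 𝔫 hg
    have hrange : adelicVal F E c N J g ∈ (GLn.ofFinite N E).range :=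
      ⟨GLn.sndHom N E (adelicVal F E c N J g), GLn.ofFinite_sndHom_of_mem hg'⟩
    have hfin : g ∈ finiteAdelic F E c N J := hrange
    rw [← range_finAdelicToAdelic] at hfin
    obtain ⟨x, rfl⟩ := hfin
    exact ⟨x, (finAdelicToAdelic_mem_congruenceLevel_iff F E c N J 𝔫 x).1 hg, rfl⟩

/-! ## 4. Non-degeneracy witness -/

omit [NumberField F] in
/-- `1 ∈ K_{U,f}(𝔫)` and the level is a genuine (nonempty, compact open) subgroup — recorded as the statement that
`K_{U,f}(𝔫)` is a compact open subgroup of the locally compact group `U(J)(𝔸_{F,f})` for every `𝔫 ≠ 0`, e.g.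
`𝔫 = ⊤` where it is the integral level `K_f⁰`. [folklore] -/
theorem isCompact_isOpen_finCongruenceLevel_top :
    IsCompact (finCongruenceLevel F E c N J ⊤ : Set (finAdelic F E c N J)) ∧
      IsOpen (finCongruenceLevel F E c N J ⊤ : Set (finAdelic F E c N J)) := by
  have h1 : (⊤ : Ideal (𝓞 E)) ≠ 0 := by rw [← Ideal.one_eq_top]; exact one_ne_zero
  exact ⟨isCompact_finCongruenceLevel F E c N J h1, isOpen_finCongruenceLevel F E c N J h1⟩

end UnitaryGroup

end Literature.NumberTheory.Automorphic

end
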